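import Summits.CriticalPhenomena.PercolationContinuityZ3.Theorems.PercNearOneGluingAdditiveGluingTBlockClasses
import HarnessLib

/-! # Crux `PercNearOneGluing.AdditiveGluing` (stmt-CriticalPhenomena-4576) — the T-form ROOT REDUCTION: `AdditiveGluing` at an observer
# from the T-functionals of its relay-free layer blocks (depth prover `png-dp-vplus`, seat (b) V⁺-form)

Support file (`--supports stmt-CriticalPhenomena-4576`); no definitions, no named facts.  Companion of `…TBlockCertificate.lean` /
`…TBlockClasses.lean` / `…TFingers.lean`.

The reusable first step of every T-form (V⁺) class theorem: for an observer `o ∉ A` (`b ∈ A`) let `q_∅` be `w` with the star of `o` killed,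
`e` a minimiser of `μ_{q_∅}(· ↔ b)` over `A` (Kozma–Nitzan's Question-9 designation) and, for a layer `N`, `q_N` = `q_∅` with `N` glued.  If every
non-empty relay-free layer `N` of POSITIVE layer mass has a non-negative T-functional at `e`,
`μ_{q_N}(N ↮ A) + μ_{q_N}(N ↔ b) − μ_{q_N}(e ↔ b) ≥ 0`, then the `AdditiveGluing` inequality holds at `o`:
`μ_w(o ↔ A) − t ≤ μ_w(o ↔ b)` for every `t ≥ 0` with `μ_w(a ↔ b) ≥ 1 − t` on `A` (`additiveGluing_of_freeLayers`).
So a CLASS of observers is settled as soon as its free layer blocks are (no free layer: Thm 4; the singleton layer `{x}`: Thm 5 /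
`additiveGluing_block_of_oneFree`; finger blocks: `additiveGluing_fingers_of_FML3`).  Proof: `T_block_certificate` at `S = {o}` and `w/{o} = w`.
[cite: KozmaNitzan2024, §3.2 (Thms 4–5 pp. 12–14), Question 9 (p. 36)]
-/

namespace Summit.CriticalPhenomena.PercolationContinuityZ3.Theorems

open MeasureTheory Set
open Literature.Probability.LatticeModels (prodBernoulli)
open Literature.Probability.Percolation (BondConfig openConn openGraph)
open scoped BigOperators Classical

noncomputable section

section TRootReduction

variable {n : ℕ}

/-- **`AdditiveGluing` at an observer from its relay-free layers.**  `b ∈ A`, `o ∉ A`; `q_∅` = `w` with the star of `o` killed.  Suppose that for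
EVERY minimiser `e ∈ A` of `μ_{q_∅}(· ↔ b)` and every non-empty layer `N` disjoint from `A` whose layer event has positive mass, the T-functional
of the glued layer block at `e` is non-negative.  Then `μ_w(o ↔ A) − t ≤ μ_w(o ↔ b)` whenever `t ≥ 0` and `μ_w(a ↔ b) ≥ 1 − t` on `A`.
[cite: KozmaNitzan2024, §3.2 pp. 12–14, Question 9 (p. 36)] -/
theorem additiveGluing_of_freeLayers (w : Sym2 (Fin n) → unitInterval) (A : Finset (Fin n)) (o b : Fin n)
    (hb : b ∈ A) (ho : o ∉ A)
    (hlayers : ∀ e ∈ A,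
      (∀ a ∈ A,
        (prodBernoulli (fun e' : Sym2 (Fin n) =>
            if (∃ y ∈ e', y ∈ ({o} : Finset (Fin n))) then (0 : unitInterval) else w e')).real (openConn e b) ≤
          (prodBernoulli (fun e' : Sym2 (Fin n) =>
            if (∃ y ∈ e', y ∈ ({o} : Finset (Fin n))) then (0 : unitInterval) else w e')).real (openConn a b)) →
      ∀ N : Finset (Fin n), N.Nonempty → Disjoint N A →
        (prodBernoulli w).real
            {ω : BondConfig (Fin n) | ∀ y : Fin n, y ∈ N ↔ (y ∉ ({o} : Finset (Fin n)) ∧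
              ∃ o' ∈ ({o} : Finset (Fin n)), s(o', y) ∈ ω)} ≠ 0 →
        0 ≤ (prodBernoulli (fun e' : Sym2 (Fin n) =>
                if (∀ y ∈ e', y ∈ N) ∧ ¬ e'.IsDiag then 1 else
                  if (∃ y ∈ e', y ∈ ({o} : Finset (Fin n))) then 0 else w e')).real
              (⋃ v ∈ N, ⋃ a ∈ A, openConn v a)ᶜ +
            (prodBernoulli (fun e' : Sym2 (Fin n) =>
                if (∀ y ∈ e', y ∈ N) ∧ ¬ e'.IsDiag then 1 else
                  if (∃ y ∈ e', y ∈ ({o} : Finset (Fin n))) then 0 else w e')).real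
              (⋃ v ∈ N, openConn v b) -
            (prodBernoulli (fun e' : Sym2 (Fin n) =>
                if (∀ y ∈ e', y ∈ N) ∧ ¬ e'.IsDiag then 1 else
                  if (∃ y ∈ e', y ∈ ({o} : Finset (Fin n))) then 0 else w e')).real
              (openConn e b)) :
    ∀ t : ℝ, 0 ≤ t →
      (∀ a ∈ A, 1 - t ≤ (prodBernoulli w).real (openConn a b)) →
      (prodBernoulli w).real (⋃ a ∈ A, openConn o a) - t ≤ (prodBernoulli w).real (openConn o b) := by
  intro t _ hA
  have hSA : Disjoint ({o} : Finset (Fin n)) A := Finset.disjoint_singleton_left.2 ho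
  obtain ⟨e, he, hmin⟩ := Finset.exists_min_image A
    (fun a => (prodBernoulli (fun e' : Sym2 (Fin n) =>
      if (∃ y ∈ e', y ∈ ({o} : Finset (Fin n))) then (0 : unitInterval) else w e')).real (openConn a b)) ⟨b, hb⟩
  have hcert := T_block_certificate w A {o} e b hb hSA he hmin
  rw [goodStep24_glue_singleton w o] at hcert
  have hsum : 0 ≤ ∑ N ∈ (Finset.univ : Finset (Finset (Fin n))).filter (fun N => N.Nonempty ∧ Disjoint N A),
      (prodBernoulli w).real
          {ω : BondConfig (Fin n) | ∀ y : Fin n, y ∈ N ↔ (y ∉ ({o} : Finset (Fin n)) ∧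
            ∃ o' ∈ ({o} : Finset (Fin n)), s(o', y) ∈ ω)} *
        ((prodBernoulli (fun e' : Sym2 (Fin n) =>
            if (∀ y ∈ e', y ∈ N) ∧ ¬ e'.IsDiag then 1 else
              if (∃ y ∈ e', y ∈ ({o} : Finset (Fin n))) then 0 else w e')).real
            (⋃ v ∈ N, ⋃ a ∈ A, openConn v a)ᶜ +
          (prodBernoulli (fun e' : Sym2 (Fin n) =>
            if (∀ y ∈ e', y ∈ N) ∧ ¬ e'.IsDiag then 1 else
              if (∃ y ∈ e', y ∈ ({o} : Finset (Fin n))) then 0 else w e')).real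
            (⋃ v ∈ N, openConn v b) -
          (prodBernoulli (fun e' : Sym2 (Fin n) =>
            if (∀ y ∈ e', y ∈ N) ∧ ¬ e'.IsDiag then 1 else
              if (∃ y ∈ e', y ∈ ({o} : Finset (Fin n))) then 0 else w e')).real
            (openConn e b)) := by
    refine Finset.sum_nonneg fun N hN => ?_
    obtain ⟨hNne, hNA⟩ := (Finset.mem_filter.1 hN).2
    by_cases h0 : (prodBernoulli w).real
          {ω : BondConfig (Fin n) | ∀ y : Fin n, y ∈ N ↔ (y ∉ ({o} : Finset (Fin n)) ∧
            ∃ o' ∈ ({o} : Finset (Fin n)), s(o', y) ∈ ω)} = 0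
    · rw [h0, zero_mul]
    · exact mul_nonneg measureReal_nonneg (hlayers e he hmin N hNne hNA h0)
  have h1 : (prodBernoulli (fun e' : Sym2 (Fin n) =>
      if (∃ y ∈ e', y ∈ ({o} : Finset (Fin n))) then (0 : unitInterval) else w e')).real (openConn e b) ≤ 1 :=
    measureReal_le_one
  have h2 : 0 ≤ (prodBernoulli w).real
          {ω : BondConfig (Fin n) | ∀ y : Fin n, y ∈ (∅ : Finset (Fin n)) ↔ (y ∉ ({o} : Finset (Fin n)) ∧
            ∃ o' ∈ ({o} : Finset (Fin n)), s(o', y) ∈ ω)} := measureReal_nonneg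
  have hT : 0 ≤ (prodBernoulli w).real (⋃ v ∈ ({o} : Finset (Fin n)), ⋃ a ∈ A, openConn v a)ᶜ +
        (prodBernoulli w).real (⋃ v ∈ ({o} : Finset (Fin n)), openConn v b) -
        (prodBernoulli w).real (openConn e b) := by
    nlinarith
  simp only [Finset.mem_singleton, Set.iUnion_iUnion_eq_left] at hT
  have hc : (prodBernoulli w).real (⋃ a ∈ A, openConn o a)ᶜ = 1 - (prodBernoulli w).real (⋃ a ∈ A, openConn o a) := by
    rw [measureReal_compl (MeasurableSet.of_discrete), probReal_univ]
  rw [hc] at hT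
  have hAe := hA e he
  linarith

/-- Registered rung `stub_additiveGluingOfFreeLayers_vp` of crux stmt-CriticalPhenomena-4576 (depth prover png-dp-vplus, seat (b) V⁺-form):
the T-form root reduction — `additiveGluing_of_freeLayers`, closed statement. [cite: KozmaNitzan2024, §3.2 pp. 12–14, Question 9 (p. 36)] -/
theorem stub_additiveGluingOfFreeLayers_vp : ∀ (n : ℕ) (w : Sym2 (Fin n) → unitInterval) (A : Finset (Fin n)) (o b : Fin n), b ∈ A → o ∉ A → (∀ e ∈ A, (∀ a ∈ A, (Literature.Probability.LatticeModels.prodBernoulli (fun e' : Sym2 (Fin n) => if (∃ y ∈ e', y ∈ ({o} : Finset (Fin n))) then (0 : unitInterval) else w e')).real (Literature.Probability.Percolation.openConn e b) ≤ (Literature.Probability.LatticeModels.prodBernoulli (fun e' : Sym2 (Fin n) => if (∃ y ∈ e', y ∈ ({o} : Finset (Fin n))) then (0 : unitInterval) else w e')).real (Literature.Probability.Percolation.openConn a b)) → ∀ N : Finset (Fin n), N.Nonempty → Disjoint N A → (Literature.Probability.LatticeModels.prodBernoulli w).real {ω : Literature.Probability.Percolation.BondConfig (Fin n) | ∀ y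 : Fin n, y ∈ N ↔ (y ∉ ({o} : Finset (Fin n)) ∧ ∃ o' ∈ ({o} : Finset (Fin n)), s(o', y) ∈ ω)} ≠ 0 → 0 ≤ (Literature.Probability.LatticeModels.prodBernoulli (fun e' : Sym2 (Fin n) => if (∀ y ∈ e', y ∈ N) ∧ ¬ e'.IsDiag then 1 else if (∃ y ∈ e', y ∈ ({o} : Finset (Fin n))) then 0 else w e')).real (⋃ v ∈ N, ⋃ a ∈ A, Literature.Probability.Percolation.openConn v a)ᶜ + (Literature.Probability.LatticeModels.prodBernoulli (fun e' : Sym2 (Fin n) => if (∀ y ∈ e', y ∈ N) ∧ ¬ e'.IsDiag then 1 else if (∃ y ∈ e', y ∈ ({o} : Finset (Fin n))) then 0 else w e')).real (⋃ v ∈ N, Literature.Probability.Percolation.openConn v b) - (Literature.Probability.LatticeModels.prodBernoulli (fun e' : Sym2 (Fin n) => if (∀ y ∈ e', y ∈ N) ∧ ¬ e'.IsDiag then 1 else if (∃ y ∈ e', y ∈ ({o} : Finset (Fin n))) then 0 else w e')).real (Literature.Probability.Percolation.openConn e b)) → ∀ t : ℝ, 0 ≤ t → (∀ a ∈ A, 1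 - t ≤ (Literature.Probability.LatticeModels.prodBernoulli w).real (Literature.Probability.Percolation.openConn a b)) → (Literature.Probability.LatticeModels.prodBernoulli w).real (⋃ a ∈ A, Literature.Probability.Percolation.openConn o a) - t ≤ (Literature.Probability.LatticeModels.prodBernoulli w).real (Literature.Probability.Percolation.openConn o b) :=
  fun _ w A o b hb ho hl => additiveGluing_of_freeLayers w A o b hb ho hl

end TRootReduction

end

end Summit.CriticalPhenomena.PercolationContinuityZ3.Theorems
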